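import Summits.BirchSwinnertonDyer.BirchSwinnertonDyer.Theorems.SchneiderFreeAdditiveX3AnticycControlAdditiveBaseCountTorsionExact
import Summits.BirchSwinnertonDyer.BirchSwinnertonDyer.Theorems.SchneiderFreeAdditiveX3AnticycControlAdditiveBaseCountFiniteAnyTorsion
import Summits.BirchSwinnertonDyer.BirchSwinnertonDyer.Theorems.SchneiderFreeAdditiveX3AnticycControlAdditiveLevelCountAnyTorsion
import Summits.BirchSwinnertonDyer.BirchSwinnertonDyer.Theorems.SchneiderFreeAdditiveX3AnticycControlAdditiveLevelLimitAnyTorsion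
import Summits.BirchSwinnertonDyer.BirchSwinnertonDyer.Theorems.SchneiderFreeAdditiveX3AnticycControlAdditiveRankOneIndicesAnyTorsion
import Summits.BirchSwinnertonDyer.BirchSwinnertonDyer.Theorems.SchneiderFreeAdditiveX3AnticycControlAdditiveLocalIndexAnyTorsion
import Summits.BirchSwinnertonDyer.Rank1Residual.Additive.LocalLogImageRat
import HarnessLib

/-!
# Crux `AnticycControlAdditiveKF` (route `SchneiderFreeAdditiveX3`, item stmt-BirchSwinnertonDyer-19548),
# regime B2 (item `ControlGlobalPTorsionF`, stmt-BirchSwinnertonDyer-19547) — THE EXACT BASE COUNT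
# `#Sel_𝔭(K, E[p^∞]) · #E(ℚ_p)[p^∞] = p^{a}` WITH global `p`-torsion (`a = a₀ + ord_p #E(K)[p^∞]`)

Seat `bsd-schneider-door-c4`, gen 3 (cell `bsd-schneider-ideate`; split agreed with seat `bsd-schneider-door-c6`
gen 2). door-c4 gen 2's `natCard_selmerAcBase_mul_eq_of_rankOne_anyReduction` (JSW17 Prop. 3.2.1 `=`, every
reduction type, port of multr1-p2) carries `E(K)[p] = 0`. Here the SAME count with ARBITRARY rational torsion:
`#Sel_𝔭(K, E[p^∞]) · #E(ℚ_p)[p^∞] = p^a`,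
`a = ord_p #Ш[p^∞] + 2((ord_p log_ω P + ord_p #Ẽ_ns(𝔽_p) − 1) − ord_p[E(K):ℤP]) + ord_p ∏_{w∣p} c_w + g`, `p^g = #E(K)[p^∞]`.
Ingredients: door-c6 gen 2's torsion-aware level engine `natCard_level_eq_of_indices_anyTorsion`, the
rank-one / local indices with torsion of `…TorsionIndices.lean` (`[E(K):p^kE(K)] = p^{k+g}`,
`ord_p[E(K):ℤP] = ord_p|c(P)| + g`, `[E(K_𝔭) : im E(K) + p^kE(K_𝔭)] = p^{e_Q − g}`), door-c6 gen 0's finiteness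
`finite_selmerAcBase_of_rankOne_anyTorsion`, this seat's level/limit relation
`natCard_level_eq_mul_natCard_selmerAcBase` (`#H¹_{𝓛^{(k)}} = #E_K[p^∞]^{Γ_K} · #Sel_𝔭`) and the
Galois-descent bridge `#E_K[p^∞]^{Γ_K} = #E(K)[p^∞]` (§1). Inside the level count the torsion CANCELS
(`#H¹_{𝓛^{(k)}} = #Ш[p^∞] · p^{2e_Q − m}` as at `g = 0`); the net `+g` is the kernel of `H¹(ι_k)`.
§1 Galois descent `natCard_fixedPoints_geomPrimaryTorsion_eq_natCard_primaryComponent`; §2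
**`natCard_selmerAcBase_mul_eq_of_rankOne_anyTorsion`** (every reduction type); §3
**`additiveBaseSelmerCountTors_of_rankOne_anyTorsion`** — (P6-add-tors) at an ADDITIVE `p`, every `g`.
CONDITIONAL on the cited `poitouTate_selmerStructure_duality K` and `localEulerPoincareCharacteristic (K_v)`
(hypotheses); inputs `rank E(K) = 1`, `Ш(E/K)` finite; NO `E(K)[p] = 0`, NO `E(ℚ_p)[p] = 0`, NO
reduction-type hypothesis in §2; no `Prop` fact minted; closes nothing by itself; BSD is not proved by this.

References: [JetchevSkinnerWan2017] Prop. 3.2.1 and (7.1.5) (arXiv:1512.06894 pp. 10–11, 16); [Castella2018]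
Thm. 2.3 and its proof; [MilneADT2006] I 4.10, 2.8; [GreenbergLNM1716] §2 p. 63, §3 Lemma 3.1, §5 Prop. 5.8;
[KellerYin2024] App. B Thm. B.0.6 (the printed count "with torsion" at a semistable prime).
-/

noncomputable section

open scoped Classical
open WeierstrassCurve NumberField IsDedekindDomain Field
open Literature.NumberTheory.EllipticCurves Literature.NumberTheory.EllipticCurves.GreenbergSelmer
  Literature.NumberTheory.EllipticCurves.ModularForms
  Literature.NumberTheory.EllipticCurves.Rank1Residual
  Literature.NumberTheory.EllipticCurves.Rank1Residual.Typed
  Literature.NumberTheory.EllipticCurves.Wuthrich2014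
  Literature.NumberTheory.EllipticCurves.BalakrishnanEtAl2019
  Literature.NumberTheory.QuadraticFields.Quadratic
  Literature.NumberTheory.Automorphic
  Literature.NumberTheory.GaloisRepresentations Literature.NumberTheory.GaloisCohomology
  Summit.BirchSwinnertonDyer.Rank1Residual
  Summit.BirchSwinnertonDyer.Rank1Residual.X11b
  Summit.BirchSwinnertonDyer.Rank1Residual.X11b.AcSelmer
  Summit.BirchSwinnertonDyer.Rank1Residual.X11b.LocBridge

set_option linter.dupNamespace false

namespace Summit.BirchSwinnertonDyer.BirchSwinnertonDyer.Theorems.SchneiderFreeAdditiveX3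


/-! ## §1. Galois descent: `#E(K̄)[p^∞]^{Γ_K} = #E(K)[p^∞]` -/
section Bridge
variable {K : Type} [Field K] [NumberField K] (E : WeierstrassCurve K) [E.IsElliptic] (p : ℕ)
  [Fact p.Prime]

omit [E.IsElliptic] [Fact p.Prime] in
/-- **Galois descent for the `p`-primary torsion: `#E(K̄)[p^∞]^{Γ_K} = #E(K)[p^∞]`.** The `Γ_K`-fixed
points of `E[p^∞] ⊆ E(K̄)` are exactly the images of the `K`-rational `p`-primary torsion points
(`exists_toGeomPoints_eq_of_forall_smul_eq`, `toGeomPoints_injective`). Silverman, *AEC*, VIII.§1;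
Greenberg LNM 1716 §3 Lemma 3.1. [cite: GreenbergLNM1716, §3 Lemma 3.1] -/
theorem natCard_fixedPoints_geomPrimaryTorsion_eq_natCard_primaryComponent :
    Nat.card {m : E.geomPrimaryTorsion p | ∀ σ : absoluteGaloisGroup K, σ • m = m} =
      Nat.card (AddCommGroup.primaryComponent E.toAffine.Point p) := by
  haveI : PerfectField K := PerfectField.ofCharZero
  -- `E(K)[p^∞] → E(K̄)[p^∞]^{Γ_K}`, `P ↦ P` read in `E(K̄)`
  let ψ : AddCommGroup.primaryComponent E.toAffine.Point p →
      {m : E.geomPrimaryTorsion p | ∀ σ : absoluteGaloisGroup K, σ • m = m} := fun P ↦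
    ⟨⟨toGeomPoints E (P : E.toAffine.Point), by
        obtain ⟨n, hn⟩ := (AddCommGroup.mem_primaryComponent).mp P.2
        exact (AddCommGroup.mem_primaryComponent).mpr ⟨n, by rw [← map_nsmul, hn, map_zero]⟩⟩,
      fun σ ↦ Subtype.ext (by
        rw [primaryComponent.coe_smul]
        exact smul_toGeomPoints E σ _)⟩
  refine (Nat.card_congr (Equiv.ofBijective ψ ⟨?_, ?_⟩)).symm
  · intro P Q hPQ
    have h := congrArg (fun z : {m : E.geomPrimaryTorsion p | ∀ σ : absoluteGaloisGroup K, σ • m = m} ↦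
      ((z : E.geomPrimaryTorsion p) : geomPoints E)) hPQ
    exact Subtype.ext (toGeomPoints_injective E h)
  · rintro ⟨m, hm⟩
    have hfix : ∀ σ : absoluteGaloisGroup K, σ • ((m : E.geomPrimaryTorsion p) : geomPoints E) =
        ((m : E.geomPrimaryTorsion p) : geomPoints E) := fun σ ↦ by
      rw [← primaryComponent.coe_smul, hm σ]
    obtain ⟨P, hP⟩ := exists_toGeomPoints_eq_of_forall_smul_eq E hfix
    obtain ⟨n, hn⟩ := (AddCommGroup.mem_primaryComponent).mp m.2
    have hPn : p ^ n • P = 0 := by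
      apply toGeomPoints_injective E
      rw [map_nsmul, hP, map_zero]
      exact hn
    refine ⟨⟨P, (AddCommGroup.mem_primaryComponent).mpr ⟨n, hPn⟩⟩, Subtype.ext (Subtype.ext hP)⟩

/-- `#E(K)[p^∞] = p^g` with `g = ord_p #E(K)[p^∞]` (the `p`-primary torsion of the Mordell–Weil group is a
finite `p`-group). [folklore] -/
theorem natCard_primaryComponent_point_eq_pow :
    Nat.card (AddCommGroup.primaryComponent E.toAffine.Point p) =
      p ^ padicValNat p (Nat.card (AddCommGroup.primaryComponent E.toAffine.Point p)) := by
  haveI : Finite (AddCommGroup.torsion E.toAffine.Point) := E.finite_torsion_point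
  rw [← LocalIndex.natCard_primaryComponent_torsion E.toAffine.Point p,
    card_addPrimaryComponent_eq_pow (A := AddCommGroup.torsion E.toAffine.Point) p, padicValNat.prime_pow]

/-- `ord_p #E(K)_tors = ord_p #E(K)[p^∞]`. [folklore] -/
theorem padicValNat_card_torsion_eq_padicValNat_card_primaryComponent :
    padicValNat p (Nat.card (AddCommGroup.torsion E.toAffine.Point)) =
      padicValNat p (Nat.card (AddCommGroup.primaryComponent E.toAffine.Point p)) := by
  haveI : Finite (AddCommGroup.torsion E.toAffine.Point) := E.finite_torsion_point
  rw [← LocalIndex.natCard_primaryComponent_torsion E.toAffine.Point p,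
    card_addPrimaryComponent_eq_pow (A := AddCommGroup.torsion E.toAffine.Point) p, padicValNat.prime_pow,
    Nat.factorization_def _ (Fact.out : p.Prime)]

/-- **`p^g · E(K̄)[p^∞]^{Γ_K} = 0` for `p^g = #E(K)[p^∞]`**: an invariant point is `K`-rational (Galois
descent) and `#E(K)[p^∞]` kills `E(K)[p^∞]`. [cite: GreenbergLNM1716, §3 Lemma 3.1] -/
theorem pow_nsmul_eq_zero_of_forall_smul_eq {k : ℕ}
    (hk : padicValNat p (Nat.card (AddCommGroup.primaryComponent E.toAffine.Point p)) ≤ k)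
    (m : E.geomPrimaryTorsion p) (hm : ∀ σ : absoluteGaloisGroup K, σ • m = m) : p ^ k • m = 0 := by
  haveI : PerfectField K := PerfectField.ofCharZero
  haveI : Finite (AddCommGroup.torsion E.toAffine.Point) := E.finite_torsion_point
  have hfix : ∀ σ : absoluteGaloisGroup K, σ • ((m : E.geomPrimaryTorsion p) : geomPoints E) =
      ((m : E.geomPrimaryTorsion p) : geomPoints E) := fun σ ↦ by
    rw [← primaryComponent.coe_smul, hm σ]
  obtain ⟨P, hP⟩ := exists_toGeomPoints_eq_of_forall_smul_eq E hfix
  obtain ⟨n, hn⟩ := (AddCommGroup.mem_primaryComponent).mp m.2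
  have hPn : p ^ n • P = 0 := by
    apply toGeomPoints_injective E
    rw [map_nsmul, hP, map_zero]
    exact hn
  -- `#E(K)[p^∞] • P = 0`
  have hPmem : P ∈ AddCommGroup.primaryComponent E.toAffine.Point p :=
    (AddCommGroup.mem_primaryComponent).mpr ⟨n, hPn⟩
  have hcard : Nat.card (AddCommGroup.primaryComponent E.toAffine.Point p) • P = 0 := by
    have h : Nat.card (AddCommGroup.primaryComponent E.toAffine.Point p) •
        (⟨P, hPmem⟩ : AddCommGroup.primaryComponent E.toAffine.Point p) = 0 := card_nsmul_eq_zero'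
    exact congrArg Subtype.val h
  rw [natCard_primaryComponent_point_eq_pow E p] at hcard
  have hkP : p ^ k • P = 0 := by
    obtain ⟨d, hd⟩ := Nat.exists_eq_add_of_le hk
    rw [hd, pow_add, mul_comm, mul_smul, hcard, smul_zero]
  apply Subtype.ext
  change p ^ k • ((m : E.geomPrimaryTorsion p) : geomPoints E) = 0
  rw [← hP, ← map_nsmul, hkP, map_zero]

end Bridge

/-! ## §2. The exact base count at a rank-one datum, every reduction type, ANY torsion -/
section Count
/-- **THE EXACT BASE SELMER COUNT at a rank-one datum, EVERY reduction type, ANY rational torsion**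
(JSW17 Prop. 3.2.1 with `=`, Keller–Yin's "control theorem which allows torsion" count at the base):
`#Sel_𝔭(K,E[p^∞]) · #E(ℚ_p)[p^∞] = p^a`,
`a = ord_p #Ш[p^∞] + 2((ord_p log_ω P + ord_p #Ẽ_ns(𝔽_p) − 1) − ord_p[E(K):ℤP]) + ord_p ∏_{w∣p} c_w + ord_p #E(K)[p^∞]`.
door-c4 gen 2's `natCard_selmerAcBase_mul_eq_of_rankOne_anyReduction` is the case `E(K)[p] = 0`.
CONDITIONAL on `poitouTate_selmerStructure_duality K` and `localEulerPoincareCharacteristic (K_v)`,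
hypotheses; `rank E(K) = 1` and `Ш(E/K)` finite are inputs.
[cite: JetchevSkinnerWan2017, Prop. 3.2.1 and (7.1.5) (arXiv:1512.06894 pp. 10–11, 16)]
[cite: KellerYin2024, App. B Thm. B.0.6 (arXiv:2402.12781 pp. 29–30)]
[cite: MilneADT2006, Ch. I, Thm. 4.10(b) and Thm. 2.8] -/
theorem natCard_selmerAcBase_mul_eq_of_rankOne_anyTorsion (W : WeierstrassCurve ℚ) [W.IsElliptic]
    [W.IsGloballyMinimal] (p : ℕ) [Fact p.Prime] (K : Type) [Field K] [NumberField K]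
    (hPT : poitouTate_selmerStructure_duality K)
    (hEP : ∀ v : HeightOneSpectrum (𝓞 K), localEulerPoincareCharacteristic (v.adicCompletion K))
    (hK : IsImaginaryQuadratic K) (hsplit : SplitsIn K p)
    (hrank : (W.baseChange K).mordellWeilRank = 1) (hSha : (W.baseChange K).ShaFinite)
    (P : (W.baseChange K).toAffine.Point) (hPinf : ¬ IsOfFinAddOrder P)
    (𝔭 : HeightOneSpectrum (𝓞 K)) (h𝔭 : ((p : ℕ) : 𝓞 K) ∈ 𝔭.asIdeal)
    (he : 𝔭.asIdeal.ramificationIdx (𝓞 ℚ) = 1) (hf : 𝔭.asIdeal.inertiaDeg (𝓞 ℚ) = 1) :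
    ∃ (_ : Finite (selmerAcBase (W.baseChange K) p 𝔭 ∅)) (a : ℕ),
      Nat.card (selmerAcBase (W.baseChange K) p 𝔭 ∅) *
          Nat.card (AddCommGroup.primaryComponent (W.baseChange ℚ_[p]).toAffine.Point p) = p ^ a ∧
      (a : ℤ) =
        (padicValNat p (Nat.card (AddCommGroup.primaryComponent (W.baseChange K).sha p)) : ℤ) +
        2 * ((X11b.padicLogOrd W p (embAt K p 𝔭 h𝔭 he hf) P + padicValNat p (reductionPointCount W p) - 1) -
          (padicValNat p (AddSubgroup.zmultiples P).index : ℤ)) +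
          padicValNat p (tamagawaProductAbove W K p) +
          padicValNat p (Nat.card (AddCommGroup.primaryComponent (W.baseChange K).toAffine.Point p)) := by
  -- adapted from door-c4 gen 2's `natCard_selmerAcBase_mul_eq_of_rankOne_anyReduction` (multr1-p2's count)
  revert P
  set E := W.baseChange K with hEdef
  set G := W.baseChange ℚ_[p] with hGdef
  intro P hPinf
  haveI hEK : E.IsElliptic := by rw [hEdef, baseChange]; infer_instance
  have h2 : Module.finrank ℚ K = 2 := hK.1
  haveI : IsTotallyComplex K := hK.2
  have hKc : ∀ w : InfinitePlace K, w.IsComplex := fun w => IsTotallyComplex.isComplex w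
  have hp : p.Prime := Fact.out
  haveI hShaFin : Finite E.sha := hSha
  haveI : Finite (AddCommGroup.torsion E.toAffine.Point) := E.finite_torsion_point
  -- finiteness of Castella's Selmer group over `K` WITHOUT `E(K)[p] = 0` (door-c6 gen 0)
  have hPTsum : poitouTate_sum_localTatePairing_eq_zero K :=
    poitouTate_sum_localTatePairing_eq_zero_of_selmerStructure_duality hPT
  have hfinSel : Finite (selmerAcBase E p 𝔭 ∅) :=
    finite_selmerAcBase_of_rankOne_anyTorsion W p K hPTsum hK hsplit hrank hSha 𝔭 h𝔭 he hf
  -- the global torsion exponent `g`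
  set g := padicValNat p (Nat.card (AddCommGroup.primaryComponent E.toAffine.Point p)) with hgdef
  have hcardg : Nat.card (AddCommGroup.primaryComponent E.toAffine.Point p) = p ^ g :=
    natCard_primaryComponent_point_eq_pow E p
  -- the `p`-adic bookkeeping of gens 16–18
  set ιp := embAt K p 𝔭 h𝔭 he hf with hιp
  set f : E.toAffine.Point →+ G.toAffine.Point := Affine.Point.map (W' := W) ιp.toRatAlgHom with hfdef
  have hfinj : Function.Injective f := Affine.Point.map_injective (W' := W) ιp.toRatAlgHom
  obtain ⟨c, Q, hcQ, hcker⟩ := RankOne.exists_coord_of_mordellWeilRank_eq_one E hrank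
  have hA : ∀ a : E.toAffine.Point, IsOfFinAddOrder (a - c a • Q) :=
    RankOne.isOfFinAddOrder_sub_coord_zsmul c Q hcQ hcker
  have hQinf : ¬ IsOfFinAddOrder Q := fun hQ => by
    have h := RankOne.coord_eq_zero_of_isOfFinAddOrder c hQ
    rw [hcQ] at h
    exact one_ne_zero h
  have hxinf : ¬ IsOfFinAddOrder (f Q) := fun hx => hQinf ((hfinj.isOfFinAddOrder_iff).mp hx)
  have hyinf : ¬ IsOfFinAddOrder (f P) := fun hy => hPinf ((hfinj.isOfFinAddOrder_iff).mp hy)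
  have hcP : c P ≠ 0 := fun h0 => hPinf (hcker P h0)
  haveI hfi2 : (G.formalFiltration 2).FiniteIndex := G.finiteIndex_formalFiltration 2
  set cp := padicValNat p (G.localTamagawaNumber ℤ_[p]) with hcpdef
  set ns := padicValNat p (reductionPointCount W p) with hnsdef
  obtain ⟨φ, hφ⟩ := LocalIndex.exists_addEquiv_valuation_psi_padicPointOf W p (K := K)
  obtain ⟨m, hmrange, hmcard, hmle⟩ :=
    LocalIndex.exists_pow_eq_card_and_le_valuation_psi (G.formalFiltration 2) φ
  set Ψ := LocalIndex.psi (G.formalFiltration 2) φ with hΨ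
  set eQ := (Ψ (f Q)).valuation with heQdef
  set eP := (Ψ (f P)).valuation with hePdef
  have hΨQ : Ψ (f Q) ≠ 0 := fun h0 => hxinf ((LocalIndex.psi_eq_zero_iff _ φ _).mp h0)
  have hmeQ : m ≤ eQ := hmle (f Q) hΨQ
  have heP : (eP : ℤ) = X11b.padicLogOrd W p ιp P + cp + ns - 1 := hφ ιp P hyinf
  have hyx : f P = c P • f Q + f (P - c P • Q) := by rw [map_sub, map_zsmul]; abel
  have hePQ : eP = padicValNat p (c P).natAbs + eQ := by
    rw [hePdef, hyx]
    exact LocalIndex.valuation_psi_zsmul_add (G.formalFiltration 2) φ hxinf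
      (f.isOfFinAddOrder (hA P)) hcP
  -- `ord_p [E(K) : ℤP] = ord_p |c(P)| + g`
  have hI : padicValNat p (AddSubgroup.zmultiples P).index = padicValNat p (c P).natAbs + g := by
    rw [padicValNat_index_zmultiples_eq_add c Q hcQ hcker P hcP, padicValNat_card_torsion_eq_padicValNat_card_primaryComponent E p]
  -- `[E(ℚ_p) : p^{k'} E(ℚ_p) + im E(K)] · p^g = p^{eQ}`, hence `g ≤ eQ`
  have hL₁g : ∀ k' : ℕ, eQ ≤ k' →
      ((Affine.Point.baseChange (W' := W.baseChange K) K (𝔭.adicCompletion K)).range ⊔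
        (zsmulAddGroupHom ((p ^ k' : ℕ) : ℤ) :
          ((W.baseChange K).baseChange (𝔭.adicCompletion K)).toAffine.Point →+ _).range).index * p ^ g =
        p ^ eQ := by
    intro k' hk'
    rw [LocalIndexTransport.index_range_baseChange_sup_eq_padic K p 𝔭 h𝔭 he hf W,
      RankOne.range_zsmulAddGroupHom_natCast, sup_comm, ← hcardg]
    change ((nsmulAddMonoidHom (p ^ k') : G.toAffine.Point →+ _).range ⊔ f.range).index * _ = _
    exact index_range_nsmul_sup_range_mul_natCard_eq (G.formalFiltration 2) φ hmrange hmcard f hfinj c Q hcQ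
      hcker hk'
  have hgeQ : g ≤ eQ := by
    have h := hL₁g eQ le_rfl
    exact (Nat.pow_dvd_pow_iff_le_right hp.one_lt).mp ⟨_, by rw [mul_comm]; exact h.symm⟩
  have htam : padicValNat p (tamagawaProductAbove W K p) = 2 * cp :=
    LocalIndexTransport.padicValNat_tamagawaProductAbove_eq_two_mul W K p h2 hsplit
  obtain ⟨σ, 𝔮, hσ, hne, h𝔮p, hall⟩ :=
    LocalIndexTransport.exists_conj_prime_of_splitsIn K p h2 hsplit h𝔭
  obtain ⟨t, ht⟩ : ∃ t : ℕ, Nat.card (AddCommGroup.primaryComponent E.sha p) = p ^ t :=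
    X11b.exists_natCard_primaryComponent_eq_pow p
  -- the exponent of Castella's Selmer group
  have hcardeq := AcSelmer.natCard_selmerAcBase_eq_natCard_selmerGroup E p 𝔭
    (∅ : Set (HeightOneSpectrum (𝓞 K)))
  haveI hfinH : Finite (acStructure (primaryGaloisModule E p) p 𝔭 ∅).selmerGroup := by
    apply Nat.finite_of_card_ne_zero
    rw [← hcardeq]
    haveI := hfinSel
    exact Nat.card_pos.ne'
  obtain ⟨k₀, -, hk₀⟩ := AcSelmer.exists_pow_nsmul_eq_zero_of_finite
    (acStructure (primaryGaloisModule E p) p 𝔭 ∅).selmerGroup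
  -- THE LEVEL `k`
  set k : ℕ := k₀ + ((eQ - m) + (eQ + t)) + g + 1 with hkdef
  have hk0 : 0 < k := by omega
  have hjk : (eQ - g) + t ≤ k := by omega
  have hsk : (eQ - m) + ((eQ - g) + t) ≤ k := by omega
  have hkill : ∀ x ∈ (acStructure (primaryGaloisModule E p) p 𝔭 ∅).selmerGroup, p ^ k • x = 0 := by
    intro x hx
    have hkk : k = (k - k₀) + k₀ := by omega
    rw [hkk, pow_add, mul_nsmul', hk₀ x hx, nsmul_zero]
  have hkΓ : ∀ m' : E.geomPrimaryTorsion p, (∀ σ : absoluteGaloisGroup K, σ • m' = m') → p ^ k • m' = 0 :=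
    pow_nsmul_eq_zero_of_forall_smul_eq E p (by omega)
  -- the level/limit relation WITH the kernel of `H¹(ι_k)` (this seat)
  have hcount : Nat.card (acLevelStructure E p k 𝔭 ∅).selmerGroup =
      p ^ g * Nat.card (selmerAcBase E p 𝔭 ∅) := by
    rw [natCard_level_eq_mul_natCard_selmerAcBase E p k 𝔭 ∅ hkΓ hkill,
      natCard_fixedPoints_geomPrimaryTorsion_eq_natCard_primaryComponent E p, hcardg]
  -- the symbolic indices at level `k`, read in `E(ℚ_p)` through `Ψ`
  have hN : ((zsmulAddGroupHom ((p ^ k : ℕ) : ℤ) : E.toAffine.Point →+ _).range).index = p ^ k * p ^ g := by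
    rw [← hcardg]
    exact index_range_zsmul_pow_eq_mul_of_le c Q hcQ hcker (by omega)
  have hM : (AddCommGroup.torsion ((W.baseChange K).baseChange (𝔭.adicCompletion K)).toAffine.Point ⊔
      (zsmulAddGroupHom ((p ^ k : ℕ) : ℤ) :
        ((W.baseChange K).baseChange (𝔭.adicCompletion K)).toAffine.Point →+ _).range).index =
      p ^ k := by
    rw [index_torsion_sup_range_zsmul_eq_padic K p 𝔭 h𝔭 he hf W,
      RankOne.range_zsmulAddGroupHom_natCast]
    exact LocalIndex.index_torsion_sup_range_nsmul (G.formalFiltration 2) φ k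
  have hL₁ : ∀ k' : ℕ, eQ ≤ k' →
      ((Affine.Point.baseChange (W' := W.baseChange K) K (𝔭.adicCompletion K)).range ⊔
        (zsmulAddGroupHom ((p ^ k' : ℕ) : ℤ) :
          ((W.baseChange K).baseChange (𝔭.adicCompletion K)).toAffine.Point →+ _).range).index =
        p ^ (eQ - g) := by
    intro k' hk'
    have h := hL₁g k' hk'
    have hsplitpow : p ^ eQ = p ^ (eQ - g) * p ^ g := by rw [← pow_add, Nat.sub_add_cancel hgeQ]
    rw [hsplitpow] at h
    exact Nat.eq_of_mul_eq_mul_right (pow_pos hp.pos g) h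
  have hL₂ : ∀ k' : ℕ, eQ - m ≤ k' →
      ((Affine.Point.baseChange (W' := W.baseChange K) K (𝔭.adicCompletion K)).range ⊔
        (AddCommGroup.torsion ((W.baseChange K).baseChange (𝔭.adicCompletion K)).toAffine.Point ⊔
          (zsmulAddGroupHom ((p ^ k' : ℕ) : ℤ) :
            ((W.baseChange K).baseChange (𝔭.adicCompletion K)).toAffine.Point →+ _).range)).index =
        p ^ (eQ - m) := by
    intro k' hk'
    rw [index_range_baseChange_sup_torsion_sup_eq_padic K p 𝔭 h𝔭 he hf W,
      RankOne.range_zsmulAddGroupHom_natCast]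
    change (f.range ⊔ (AddCommGroup.torsion G.toAffine.Point ⊔
      (nsmulAddMonoidHom (p ^ k') : G.toAffine.Point →+ _).range)).index = _
    have hrw : f.range ⊔ (AddCommGroup.torsion G.toAffine.Point ⊔
        (nsmulAddMonoidHom (p ^ k') : G.toAffine.Point →+ _).range) =
        AddCommGroup.torsion G.toAffine.Point ⊔
          ((nsmulAddMonoidHom (p ^ k') : G.toAffine.Point →+ _).range ⊔
            AddSubgroup.zmultiples (f Q)) := by
      rw [← torsion_sup_range_nsmul_sup_range_eq f c Q hA (p ^ k')]
      ac_rfl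
    rw [hrw, LocalIndex.index_torsion_sup_range_nsmul_sup_zmultiples (G.formalFiltration 2) φ
      hmrange (f Q) hxinf k', min_eq_right hk']
  have hS := SelmerCount.natCard_sha_inf_torsionBy_eq E p ht (show t ≤ k by omega)
  have hShaj : ∀ z ∈ E.sha ⊓ AddSubgroup.torsionBy E.galH1 ((p ^ k : ℕ) : ℤ), p ^ t • z = 0 :=
    fun z hz => SelmerCount.pow_nsmul_eq_zero_of_mem_sha_inf_torsionBy E p ht k hz
  -- THE EXACT LEVEL COUNT with torsion (door-c6 gen 2)
  obtain ⟨-, hlevel⟩ := natCard_level_eq_of_indices_anyTorsion W K p k 𝔭 𝔮 hKc hk0 σ hσ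
    h𝔮p hne hall hPT hEP (exceptionalPlaces W K p h2) (inl_mem_exceptionalPlaces h2)
    (fun v hv => inr_mem_exceptionalPlaces_of_mem h2 hv)
    (fun v hv => inr_mem_exceptionalPlaces_of_not_hasGoodReductionAt h2 hv)
    (inr_mem_exceptionalPlaces_of_mem h2 h𝔮p) hjk hsk hN hM (hL₁ k (by omega))
    (hL₁ (k - t) (by omega)) (hL₂ k (by omega)) (hL₂ (k - ((eQ - g) + t)) (by omega)) hS hShaj
  -- assemble: `p^g · #Sel = p^t · p^{(eQ-g)+(eQ-m)} · p^g`
  have hSel : Nat.card (selmerAcBase E p 𝔭 ∅) = p ^ (t + ((eQ - g) + (eQ - m))) := by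
    have h : p ^ g * Nat.card (selmerAcBase E p 𝔭 ∅) = p ^ g * p ^ (t + ((eQ - g) + (eQ - m))) := by
      rw [← hcount, hlevel, ht, ← pow_add]; ring
    exact Nat.eq_of_mul_eq_mul_left (pow_pos hp.pos g) h
  refine ⟨hfinSel, t + (eQ - g) + eQ, ?_, ?_⟩
  · rw [← hmcard, hSel, ← pow_add]
    congr 1
    omega
  · have hvS : padicValNat p (Nat.card (AddCommGroup.primaryComponent E.sha p)) = t := by
      rw [ht, padicValNat.prime_pow]
    rw [hvS, hI, htam]
    have hePQZ : (eP : ℤ) = (padicValNat p (c P).natAbs : ℤ) + (eQ : ℤ) := by exact_mod_cast hePQ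
    have hcast : (((t + (eQ - g) + eQ : ℕ) : ℤ)) = (t : ℤ) + ((eQ : ℤ) - (g : ℤ)) + (eQ : ℤ) := by
      push_cast [Nat.cast_sub hgeQ]; ring
    have hcast2 : (((2 * cp : ℕ) : ℤ)) = 2 * (cp : ℤ) := by push_cast; ring
    rw [hcast, hcast2]
    push_cast
    linarith [hePQZ, heP]

end Count

/-! ## §3. (P6-add-tors) at an ADDITIVE prime, every `g` -/
section Additive
/-- **(P6-add-tors), ANY torsion** — the base count at an ADDITIVE prime (`#Ẽ_ns(𝔽_p) = p`):
`#Sel_𝔭(K,E[p^∞]) · #E(ℚ_p)[p^∞] = p^a`,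
`a = ord_p #Ш[p^∞] + 2(ord_p log_ω P − ord_p[E(K):ℤP]) + ord_p ∏_{w∣p} c_w + ord_p #E(K)[p^∞]`.
With `t_p := ord_p #E(ℚ_p)[p^∞]`, `g := ord_p #E(K)[p^∞]` this is door-c4 gen 0's glue atom
"`#Sel = p^{a'}`, `a' = … + g − t`" at `t = t_p`. door-c4 gen 2's `additiveBaseSelmerCountTors_of_rankOne`
is the case `g = 0`. CONDITIONAL on the two cited facts; inputs `rank E(K) = 1`, `Ш(E/K)` finite.
[cite: JetchevSkinnerWan2017, Prop. 3.2.1 and (7.1.5) (arXiv:1512.06894 pp. 10–11, 16)]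
[cite: KellerYin2024, App. B Thm. B.0.6 (arXiv:2402.12781 pp. 29–30)] [cite: MilneADT2006, Ch. I, Thm. 4.10(b) and Thm. 2.8] -/
theorem additiveBaseSelmerCountTors_of_rankOne_anyTorsion (W : WeierstrassCurve ℚ) [W.IsElliptic]
    [W.IsGloballyMinimal] (p : ℕ) [Fact p.Prime] (K : Type) [Field K] [NumberField K]
    (hPT : poitouTate_selmerStructure_duality K)
    (hEP : ∀ v : HeightOneSpectrum (𝓞 K), localEulerPoincareCharacteristic (v.adicCompletion K))
    (hadd : Addv W p) (hK : IsImaginaryQuadratic K) (hsplit : SplitsIn K p)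
    (hrank : (W.baseChange K).mordellWeilRank = 1) (hSha : (W.baseChange K).ShaFinite)
    (P : (W.baseChange K).toAffine.Point) (hPinf : ¬ IsOfFinAddOrder P)
    (𝔭 : HeightOneSpectrum (𝓞 K)) (h𝔭 : ((p : ℕ) : 𝓞 K) ∈ 𝔭.asIdeal)
    (he : 𝔭.asIdeal.ramificationIdx (𝓞 ℚ) = 1) (hf : 𝔭.asIdeal.inertiaDeg (𝓞 ℚ) = 1) :
    ∃ (_ : Finite (selmerAcBase (W.baseChange K) p 𝔭 ∅)) (a : ℕ),
      Nat.card (selmerAcBase (W.baseChange K) p 𝔭 ∅) *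
          Nat.card (AddCommGroup.primaryComponent (W.baseChange ℚ_[p]).toAffine.Point p) = p ^ a ∧
      (a : ℤ) =
        (padicValNat p (Nat.card (AddCommGroup.primaryComponent (W.baseChange K).sha p)) : ℤ) +
        2 * (X11b.padicLogOrd W p (embAt K p 𝔭 h𝔭 he hf) P -
          (padicValNat p (AddSubgroup.zmultiples P).index : ℤ)) +
          padicValNat p (tamagawaProductAbove W K p) +
          padicValNat p (Nat.card (AddCommGroup.primaryComponent (W.baseChange K).toAffine.Point p)) := by
  obtain ⟨hfin, a, hcard, ha⟩ := natCard_selmerAcBase_mul_eq_of_rankOne_anyTorsion W p K hPT hEP hK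
    hsplit hrank hSha P hPinf 𝔭 h𝔭 he hf
  refine ⟨hfin, a, hcard, ?_⟩
  have hns : padicValNat p (reductionPointCount W p) = 1 := by
    rw [Additive.LocalLog.reductionPointCount_of_addv W p hadd, padicValNat_self]
  rw [ha, hns]
  push_cast
  ring

end Additive
end Summit.BirchSwinnertonDyer.BirchSwinnertonDyer.Theorems.SchneiderFreeAdditiveX3

end
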